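import Summits.QuantumFields.BalabanUV.T4Continuum.Support.NE7K1LinSchurLineSetDecay
import Summits.QuantumFields.BalabanUV.T4Continuum.Support.NE7K1LinSchurLineU1
import Literature.MathematicalPhysics.QuantumFieldTheory.Balaban1983to89.B4RegionCov1518

/-!
# NE7K1LinSchurLineU1Set — row NE7 (node U5), candidate route HOM, path H1L, cell K1-lin(s): B4 COROLLARY 2.3 (2.30), FIRST
# PAIRING, FOR THE TWO-CUTOFF LINE ON EVERY UNION OF BLOCKS — the `L²` set-to-set bound
# `‖1_S (twoCutoffLine s)⁻¹ 1_T‖ ≤ (2L^{d+1}∕min(2,a))·e^{−δ·dist_η(S,T)}`, EVERY `s ∈ [0,1]`, EVERY mesh, EVERY region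

Lineage `b2b-balaban-t4-ne7-p2` (CRUX PROVER NE7 #2), generation 78; file 86.  NEEDS-ESTIMATE #E1, item (o3-Ω) («a Cor.
2.3-type `L²` statement for the LINE on a non-box region», PRICING-NE7 v39 §285 ∕ v40 §291–§292; K1LIN-LINE v1.20 §3w «would
need Combes–Thomas for the exponentially-localised Schur complement»).  THE ANSWER: no new Combes–Thomas — the √s-EXTENDED
operator of `NE7K1LinSchurLineForm` is local in block coordinates, file 85's `lineOpR_inv_setDecay_form` is its `L²` bound,
and this file instantiates it EXACTLY as `NE7K1LinSchurLineU1.twoCutoff_inv_decay` instantiated the entrywise one: same two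
runs (`runA = fineOpR n a 0 R`, `runB` = `fineOpR (nL) a 0 R′` in block coordinates), same floor `σ = min(2,a)∕L^{d+1}`, same
mesh-free window `2(2(d+1)(δL)² + a(e^δ − 1)) ≤ σ∕2`, with the weight `δ·dist_η(·, T)` (`Beta.CombesThomasFormOp.distTo` over
`B4Lower18.edistR`, as b04's `B4RegionCov1518.setDecay_region_mass` for the endpoint) in place of `δ·dist_η(·, y)`.

* §1 the weight `dT = dist_η(·,T)` on run A's sites: `1∕n`-Lipschitz in the sup norm (`abs_dT_sub_le`), `≤ 0` on `T`, `≥ ρ₀`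
  on a set `S` at `η`-distance `≥ ρ₀` from `T`.
* §2 **`twoCutoff_inv_setDecay`**: for `a > 0`, `n ≥ 1`, `R′` a union of `nL`-blocks, `0 ≤ δ ≤ 1` in the window, `s ∈ [0,1]`,
  `T ≠ ∅`, `dist_η(S,T) ≥ ρ₀`, `supp g ⊆ T`:
  `Σ_{x∈S}((twoCutoffLine s)⁻¹g)(x)² ≤ (2∕σ)²·e^{−2δρ₀}·Σ_x g(x)²` — every constant independent of `n`, `s` and the region;
  **`twoCutoff_inv_pairing_sq_le`**: `⟨f,(twoCutoffLine s)⁻¹g⟩² ≤ (2∕σ)²e^{−2δρ₀}(Σf²)(Σg²)` for `supp f ⊆ S` — B4 (2.30)'s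
  FIRST pairing for the line (`c₀ = 2L^{d+1}∕min(2,a)`, rate `δ` of the window), in counting `ℓ²` norms (the paper's
  `η^{d+1}`-weighted norms scale both sides alike, as in b04's `B4Cor23Zero`).
* §3 THE REGION = B4's: for every finite set `Ω` of unit labels, `R′ = fineDom L (fineDom n Ω)` is a union of `nL`-blocks
  (`isBlockUnion_fineDom_fineDom`) and run A's sites are `fineDom n Ω` (`image_blk_fineDom_fineDom`) — the form in which
  files 87–89 consume §2 on b04's region index.

HONEST FRAMING: [folklore]; A = 0 (U = 1); the three DERIVATIVE pairings of (2.30) (`D_μG`, `GD_ν^*`, `D_μGD_ν^*`) are NOT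
typed for the line here (b04 has them for the endpoint, `B4Cor23Zero`; for the line they need the extended-system energy
bookkeeping — a successor's option, no consumer named); the `δG(Ω,Ω₀)` clause of the Corollary for the line is the (RW)
series' (`NE7K1LinWalkLineDelta`, big blocks, threshold), not a Combes–Thomas statement; nothing printed asserted; no
`sorry`.  Census only; NE7 NOT PRINTED ∕ NOT PROVED; spine 0∕9; FIXED FINITE T⁴, rung (B)+1; NOT infinite volume, NOT mass gap,
NOT Clay.  HONEST DEPENDENCY: continuum YM on T⁴ ⇐ BetaPertH ∧ nine spine estimates (0/9 proved); BetaPertH ⇐ (D1) ∧ (D4) ∧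
CAP+tail; G-an2-4 gates asym, D1 and NE2/3/4.
-/

noncomputable section

open Finset Matrix

namespace Summit.QuantumFields.BalabanUV.T4Continuum.NE7K1LinSchurLineU1Set

open Literature.MathematicalPhysics.QuantumFieldTheory.Balaban1983to89
open Literature.MathematicalPhysics.QuantumFieldTheory.Balaban1983to89.B4ContourShift (supNorm supNorm_nonneg abs_le_supNorm)
open Literature.MathematicalPhysics.QuantumFieldTheory.Balaban1983to89.B4Reflection242
open Literature.MathematicalPhysics.QuantumFieldTheory.Balaban1983to89.B4BoxCov237
open Literature.MathematicalPhysics.QuantumFieldTheory.Balaban1983to89.B4Lower18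
open Literature.MathematicalPhysics.QuantumFieldTheory.Balaban1983to89.B4Thm110ZeroBox (blk_blk)
open Literature.MathematicalPhysics.QuantumFieldTheory.Balaban1983to89.B4Green244 (finePt)
open Literature.MathematicalPhysics.QuantumFieldTheory.Balaban1983to89.B4RegionCov1518 (edistR_symm edistR_self
  edistR_triangle)
open Literature.MathematicalPhysics.QuantumFieldTheory.Balaban1983to89.Beta.CombesThomasFormOp (distTo distTo_le le_distTo
  distTo_le_zero_of_mem abs_distTo_sub_le)
open NE7K1LinSchurLineForm NE7K1LinSchurLineCoords NE7K1LinFineOpWeight NE7K1LinBlockCoords NE7K1LinSchurLineU1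
open NE7K1LinSchurLineSetDecay

variable {d : ℕ}

/-! ### §1 The weight `dist_η(·, T)` on run A's sites -/

section Weight

variable {n : ℕ} {R : Finset (Fin (d + 1) → ℤ)}

/-- `dT = dist_η(·,T)` = the `η`-sup-distance to the nonempty source set `T`. [folklore] -/
def dT (n : ℕ) (R : Finset (Fin (d + 1) → ℤ)) (T : Finset ↥R) (hT : T.Nonempty) (x : ↥R) : ℝ :=
  distTo (edistR n R) T hT x

/-- `dist_η(·,T)` is `(1∕n)`-Lipschitz in the sup norm: `|dT x − dT z| ≤ (1∕n)|x − z|_∞`. [folklore] -/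
theorem abs_dT_sub_le (hn : 1 ≤ n) (T : Finset ↥R) (hT : T.Nonempty) (x z : ↥R) :
    |dT n R T hT x - dT n R T hT z| ≤ (1 / (n : ℝ)) * supNorm (x.1 - z.1) :=
  abs_distTo_sub_le (edistR n R) (edistR_symm n R) (edistR_triangle hn R) T hT x z

/-- on the source set the weight is `≤ 0`. [folklore] -/
theorem dT_le_zero_of_mem (T : Finset ↥R) (hT : T.Nonempty) {x : ↥R} (hx : x ∈ T) : dT n R T hT x ≤ 0 :=
  distTo_le_zero_of_mem (edistR n R) (edistR_self n R) T hT hx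

/-- a common lower bound of the `η`-distances to `T` bounds the weight from below. [folklore] -/
theorem le_dT (T : Finset ↥R) (hT : T.Nonempty) {x : ↥R} {ρ₀ : ℝ} (h : ∀ t ∈ T, ρ₀ ≤ edistR n R x t) :
    ρ₀ ≤ dT n R T hT x :=
  le_distTo (edistR n R) T hT h

end Weight

/-! ### §2 B4 (2.30), FIRST PAIRING, FOR THE TWO-CUTOFF LINE: the `L²` set-to-set bound, mesh- and `s`-uniform -/

section TwoCutoff

variable {n L : ℕ} [NeZero L] {R' : Finset (Fin (d + 1) → ℤ)}

/-- **B4 COR. 2.3 (2.30), FIRST PAIRING, FOR THE TWO-CUTOFF LINE — `L²` SET-TO-SET FORM.**  For `a > 0`, `n ≥ 1`, `R′` a union of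
`nL`-blocks, `0 ≤ δ ≤ 1` with `2(2(d+1)(δL)² + a(e^δ − 1)) ≤ (min(2,a)∕L^{d+1})∕2` (the mesh does NOT appear), `s ∈ [0,1]`, a
nonempty set `T` of run-A sites, a set `S` with `dist_η(S,T) ≥ ρ₀` and a source `g` supported in `T`: the line is invertible and
`Σ_{x∈S}((twoCutoffLine s)⁻¹g)(x)² ≤ (2∕(min(2,a)∕L^{d+1}))²·e^{−2δρ₀}·Σ_x g(x)²`. [folklore] -/
theorem twoCutoff_inv_setDecay (hn : 1 ≤ n) (hR' : IsBlockUnion (n * L) R') {a δ : ℝ} (ha : 0 < a) (hδ0 : 0 ≤ δ)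
    (hδ1 : δ ≤ 1)
    (hsmall : 2 * (2 * ((d : ℝ) + 1) * (δ * L) ^ 2 + a * (Real.exp δ - 1)) ≤ (min 2 a / (L : ℝ) ^ (d + 1)) / 2)
    {s : ℝ} (hs0 : 0 ≤ s) (hs1 : s ≤ 1) (S T : Finset ↥(R'.image (blk L))) (hT : T.Nonempty) (ρ₀ : ℝ)
    (hρ₀ : ∀ x ∈ S, ∀ t ∈ T, ρ₀ ≤ edistR n (R'.image (blk L)) x t)
    (g : ↥(R'.image (blk L)) → ℝ) (hg : ∀ x, x ∉ T → g x = 0) :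
    IsUnit (twoCutoffLine (isBlockUnion_fine hR') n a s).det ∧
      ∑ x ∈ S, ((twoCutoffLine (isBlockUnion_fine hR') n a s)⁻¹.mulVec g) x ^ 2 ≤
        (2 / (min 2 a / (L : ℝ) ^ (d + 1))) ^ 2 * Real.exp (-(2 * (δ * ρ₀))) * ∑ x, g x ^ 2 := by
  classical
  have hL : 1 ≤ L := NeZero.one_le
  have hR'L : IsBlockUnion L R' := isBlockUnion_fine hR'
  have hRc : IsBlockUnion n (R'.image (blk L)) := isBlockUnion_coarse hL hR'
  have hnL : 1 ≤ n * L := Nat.one_le_iff_ne_zero.2 (Nat.mul_ne_zero (Nat.one_le_iff_ne_zero.1 hn) (NeZero.ne L))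
  have hn0 : (0 : ℝ) < n := by exact_mod_cast hn
  have hL0 : (0 : ℝ) < L := by exact_mod_cast hL
  have hLpow : (0 : ℝ) < (L : ℝ) ^ (d + 1) := by positivity
  have hLpow1 : (1 : ℝ) ≤ (L : ℝ) ^ (d + 1) := one_le_pow₀ (by exact_mod_cast hL)
  have hmin : 0 < min 2 a := lt_min (by norm_num) ha
  set σ : ℝ := min 2 a / (L : ℝ) ^ (d + 1) with hσdef
  have hσ : 0 < σ := div_pos hmin hLpow
  have hσle : σ ≤ min 2 a := div_le_self hmin.le hLpow1
  have hexp : 0 ≤ Real.exp δ - 1 := by linarith [Real.add_one_le_exp δ]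
  -- the weight: δ × physical sup-distance to `T`, pulled back block-constantly
  set ρ : ↥(R'.image (blk L)) ⊕ (↥(R'.image (blk L)) × NZ d L) → ℝ :=
    fun c => δ * dT n (R'.image (blk L)) T hT (site c) with hρ
  set ρ' : ↥R' → ℝ := fun x' => δ * dT n (R'.image (blk L)) T hT (rblk L R' x') with hρ'
  -- (1) coercivity of run A
  have hP₀ : ∀ g : ↥(R'.image (blk L)) → ℝ, σ * (g ⬝ᵥ g) ≤ g ⬝ᵥ (runA n L a R').mulVec g := by
    intro g
    have hg : 0 ≤ g ⬝ᵥ g := by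
      simp only [dotProduct]; exact Finset.sum_nonneg fun _ _ => mul_self_nonneg _
    exact (mul_le_mul_of_nonneg_right hσle hg).trans (lower18_zero hn ha.le hRc g)
  -- (2) coercivity of run B in block coordinates
  have hH₁ : ∀ u, σ * (u ⬝ᵥ u) ≤ u ⬝ᵥ (runB hR'L n a).mulVec u := by
    intro u
    have h := coercive_congr (coordT hR'L) (fineOpR (n * L) a 0 R') (c := ((L : ℝ) ^ (d + 1))⁻¹) (σM := min 2 a)
      (cT := 1) (by positivity) hmin.le (fun φ => lower18_zero hnL ha.le hR' φ) (dot_le_coordT hR'L) u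
    have hσ' : ((L : ℝ) ^ (d + 1))⁻¹ * min 2 a * 1 = σ := by rw [hσdef]; field_simp
    rw [hσ'] at h
    exact h
  -- (3) conjugation error of run A at the weight `ρ ∘ inl`
  have hbondA : ∀ x₁ x₂ : ↥(R'.image (blk L)), x₂.1 ∈ nbrs x₁.1 →
      |ρ (Sum.inl x₁) - ρ (Sum.inl x₂)| ≤ δ * (1 / (n : ℝ)) := by
    intro x₁ x₂ h12
    simp only [hρ, site, ← mul_sub, abs_mul, abs_of_nonneg hδ0]
    refine mul_le_mul_of_nonneg_left ((abs_dT_sub_le hn T hT x₁ x₂).trans ?_) hδ0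
    exact (mul_le_mul_of_nonneg_left (supNorm_sub_le_one_of_mem_nbrs h12) (by positivity)).trans (by rw [mul_one])
  have hblockA : ∀ x₁ x₂ : ↥(R'.image (blk L)), blk n x₁.1 = blk n x₂.1 → |ρ (Sum.inl x₁) - ρ (Sum.inl x₂)| ≤ δ := by
    intro x₁ x₂ h12
    simp only [hρ, site, ← mul_sub, abs_mul, abs_of_nonneg hδ0]
    refine (mul_le_mul_of_nonneg_left ((abs_dT_sub_le hn T hT x₁ x₂).trans ?_) hδ0).trans (by rw [mul_one])
    calc (1 / (n : ℝ)) * supNorm (x₁.1 - x₂.1) ≤ (1 / (n : ℝ)) * ((n : ℝ) - 1) :=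
          mul_le_mul_of_nonneg_left (supNorm_sub_le_of_blk_eq hn h12) (by positivity)
      _ ≤ 1 := by rw [div_mul_eq_mul_div, one_mul, div_le_one hn0]; linarith
  have h₀ : ∀ g : ↥(R'.image (blk L)) → ℝ, -(σ / 2) * (g ⬝ᵥ g) ≤
      ∑ j, ∑ k, (Real.exp (ρ (Sum.inl j) - ρ (Sum.inl k)) - 1) * runA n L a R' j k * (g j * g k) := by
    intro g
    have hδn : δ * (1 / (n : ℝ)) ≤ 1 := by
      calc δ * (1 / (n : ℝ)) ≤ 1 * 1 :=
            mul_le_mul hδ1 (by rw [div_le_one hn0]; exact_mod_cast hn) (by positivity) zero_le_one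
        _ = 1 := one_mul 1
    have h := conjError_fineOpR_ge hn hRc ha.le hδn hδ0 (fun z => ρ (Sum.inl z)) hbondA hblockA g
    have hg : 0 ≤ g ⬝ᵥ g := by
      simp only [dotProduct]; exact Finset.sum_nonneg fun _ _ => mul_self_nonneg _
    have hκ : 2 * ((d : ℝ) + 1) * δ ^ 2 + a * (Real.exp δ - 1) ≤ σ / 2 := by
      have hL1 : (1 : ℝ) ≤ (L : ℝ) := by exact_mod_cast hL
      have hδL : δ ^ 2 ≤ (δ * L) ^ 2 := by
        rw [mul_pow]
        nlinarith [sq_nonneg δ, mul_nonneg (sq_nonneg δ) (by nlinarith : (0 : ℝ) ≤ (L : ℝ) ^ 2 - 1)]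
      nlinarith [mul_nonneg ha.le hexp, hδL]
    exact le_trans (by nlinarith) h
  -- (4) conjugation error of run B in block coordinates at the weight `ρ` (compatible with `ρ'`)
  have hcompat : ∀ x' c, coordT hR'L x' c ≠ 0 → ρ' x' = ρ c := by
    intro x' c h
    simp only [hρ, hρ', coordT_compat hR'L x' c h]
  have hbondB : ∀ x₁ x₂ : ↥R', x₂.1 ∈ nbrs x₁.1 → |ρ' x₁ - ρ' x₂| ≤ (δ * L) * (1 / ((n * L : ℕ) : ℝ)) := by
    intro x₁ x₂ h12
    simp only [hρ', ← mul_sub, abs_mul, abs_of_nonneg hδ0]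
    have hkey : (1 / (n : ℝ)) * supNorm ((rblk L R' x₁).1 - (rblk L R' x₂).1) ≤ 1 / (n : ℝ) := by
      have hb : supNorm ((rblk L R' x₁).1 - (rblk L R' x₂).1) ≤ 1 :=
        supNorm_blk_sub_blk_le_one hL (supNorm_sub_le_one_of_mem_nbrs h12)
      exact (mul_le_mul_of_nonneg_left hb (by positivity)).trans (by rw [mul_one])
    have h1 : |dT n (R'.image (blk L)) T hT (rblk L R' x₁) - dT n (R'.image (blk L)) T hT (rblk L R' x₂)| ≤ 1 / (n : ℝ) :=
      (abs_dT_sub_le hn T hT _ _).trans hkey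
    have hnL' : (δ * L) * (1 / ((n * L : ℕ) : ℝ)) = δ * (1 / (n : ℝ)) := by
      push_cast
      field_simp
    rw [hnL']
    exact mul_le_mul_of_nonneg_left h1 hδ0
  have hblockB : ∀ x₁ x₂ : ↥R', blk (n * L) x₁.1 = blk (n * L) x₂.1 → |ρ' x₁ - ρ' x₂| ≤ δ := by
    intro x₁ x₂ h12
    simp only [hρ', ← mul_sub, abs_mul, abs_of_nonneg hδ0]
    have hbb : blk n (rblk L R' x₁).1 = blk n (rblk L R' x₂).1 := by
      show blk n (blk L x₁.1) = blk n (blk L x₂.1)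
      rw [blk_blk, blk_blk, Nat.mul_comm]; exact h12
    refine (mul_le_mul_of_nonneg_left ((abs_dT_sub_le hn T hT _ _).trans ?_) hδ0).trans (by rw [mul_one])
    calc (1 / (n : ℝ)) * supNorm ((rblk L R' x₁).1 - (rblk L R' x₂).1) ≤ (1 / (n : ℝ)) * ((n : ℝ) - 1) :=
          mul_le_mul_of_nonneg_left (supNorm_sub_le_of_blk_eq hn hbb) (by positivity)
      _ ≤ 1 := by rw [div_mul_eq_mul_div, one_mul, div_le_one hn0]; linarith
  have h₁ : ∀ u, -(σ / 2) * (u ⬝ᵥ u) ≤ ∑ j, ∑ k, (Real.exp (ρ j - ρ k) - 1) * runB hR'L n a j k * (u j * u k) := by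
    intro u
    have hδn : (δ * L) * (1 / ((n * L : ℕ) : ℝ)) ≤ 1 := by
      have : (δ * L) * (1 / ((n * L : ℕ) : ℝ)) = δ * (1 / (n : ℝ)) := by push_cast; field_simp
      rw [this]
      calc δ * (1 / (n : ℝ)) ≤ 1 * 1 :=
            mul_le_mul hδ1 (by rw [div_le_one hn0]; exact_mod_cast hn) (by positivity) zero_le_one
        _ = 1 := one_mul 1
    have hM := conjError_fineOpR_ge hnL hR' ha.le hδn hδ0 ρ' hbondB hblockB
    have h := conjError_congr_ge (coordT hR'L) (fineOpR (n * L) a 0 R') (c := ((L : ℝ) ^ (d + 1))⁻¹)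
      (κM := 2 * ((d : ℝ) + 1) * (δ * L) ^ 2 + a * (Real.exp δ - 1)) (CT := (L : ℝ) ^ (d + 1) + 1) (by positivity)
      (by nlinarith [mul_nonneg ha.le hexp, sq_nonneg (δ * L)]) ρ ρ' hcompat
      hM (coordT_le_dot hR'L) u
    have hu : 0 ≤ u ⬝ᵥ u := by
      simp only [dotProduct]; exact Finset.sum_nonneg fun _ _ => mul_self_nonneg _
    have hcC : ((L : ℝ) ^ (d + 1))⁻¹ * ((L : ℝ) ^ (d + 1) + 1) ≤ 2 := by
      rw [inv_mul_eq_div, div_le_iff₀ hLpow]; linarith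
    have hκ : ((L : ℝ) ^ (d + 1))⁻¹ * (2 * ((d : ℝ) + 1) * (δ * L) ^ 2 + a * (Real.exp δ - 1)) *
        ((L : ℝ) ^ (d + 1) + 1) ≤ σ / 2 := by
      have hk0 : 0 ≤ 2 * ((d : ℝ) + 1) * (δ * L) ^ 2 + a * (Real.exp δ - 1) := by
        nlinarith [mul_nonneg ha.le hexp, sq_nonneg (δ * L)]
      calc ((L : ℝ) ^ (d + 1))⁻¹ * (2 * ((d : ℝ) + 1) * (δ * L) ^ 2 + a * (Real.exp δ - 1)) * ((L : ℝ) ^ (d + 1) + 1)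
          = (((L : ℝ) ^ (d + 1))⁻¹ * ((L : ℝ) ^ (d + 1) + 1)) *
              (2 * ((d : ℝ) + 1) * (δ * L) ^ 2 + a * (Real.exp δ - 1)) := by ring
        _ ≤ 2 * (2 * ((d : ℝ) + 1) * (δ * L) ^ 2 + a * (Real.exp δ - 1)) := mul_le_mul_of_nonneg_right hcC hk0
        _ ≤ σ / 2 := hsmall
    exact le_trans (by nlinarith) h
  -- (5) assemble through file 85's set-decay theorem (H_B = fromBlocks of its blocks)
  have hHB : fromBlocks (runB hR'L n a).toBlocks₁₁ (runB hR'L n a).toBlocks₁₂ (runB hR'L n a).toBlocks₂₁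
      (runB hR'L n a).toBlocks₂₂ = runB hR'L n a := fromBlocks_toBlocks _
  have main := lineOpR_inv_setDecay_form (runA n L a R') (runB hR'L n a).toBlocks₁₁ (runB hR'L n a).toBlocks₁₂
    (runB hR'L n a).toBlocks₂₁ (runB hR'L n a).toBlocks₂₂ hσ ρ hP₀ (by rw [hHB]; exact hH₁) h₀ (by rw [hHB]; exact h₁)
    hs0 hs1 S T (δ * ρ₀) 0 (fun x hx => ?_) (fun t ht => ?_) g hg
  · refine ⟨main.1, ?_⟩
    have h := main.2
    rw [sub_zero] at h
    simpa only [twoCutoffLine] using h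
  · -- on `S` the weight is `≥ δρ₀`
    exact mul_le_mul_of_nonneg_left (le_dT T hT fun t ht => hρ₀ x hx t ht) hδ0
  · -- on `T` the weight is `≤ 0`
    exact mul_nonpos_iff.2 (Or.inl ⟨hδ0, dT_le_zero_of_mem T hT ht⟩)

/-- **B4 COR. 2.3 (2.30), FIRST PAIRING, FOR THE TWO-CUTOFF LINE — PAIRING FORM**: under the same hypotheses, for `supp f ⊆ S`
and `supp g ⊆ T`, `⟨f, (twoCutoffLine s)⁻¹g⟩² ≤ (2∕(min(2,a)∕L^{d+1}))²·e^{−2δρ₀}·(Σf²)(Σg²)`. [folklore] -/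
theorem twoCutoff_inv_pairing_sq_le (hn : 1 ≤ n) (hR' : IsBlockUnion (n * L) R') {a δ : ℝ} (ha : 0 < a) (hδ0 : 0 ≤ δ)
    (hδ1 : δ ≤ 1)
    (hsmall : 2 * (2 * ((d : ℝ) + 1) * (δ * L) ^ 2 + a * (Real.exp δ - 1)) ≤ (min 2 a / (L : ℝ) ^ (d + 1)) / 2)
    {s : ℝ} (hs0 : 0 ≤ s) (hs1 : s ≤ 1) (S T : Finset ↥(R'.image (blk L))) (hT : T.Nonempty) (ρ₀ : ℝ)
    (hρ₀ : ∀ x ∈ S, ∀ t ∈ T, ρ₀ ≤ edistR n (R'.image (blk L)) x t)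
    (f g : ↥(R'.image (blk L)) → ℝ) (hf : ∀ x, x ∉ S → f x = 0) (hg : ∀ x, x ∉ T → g x = 0) :
    (f ⬝ᵥ (twoCutoffLine (isBlockUnion_fine hR') n a s)⁻¹.mulVec g) ^ 2 ≤
      (2 / (min 2 a / (L : ℝ) ^ (d + 1))) ^ 2 * Real.exp (-(2 * (δ * ρ₀))) * (∑ x, f x ^ 2) * (∑ x, g x ^ 2) := by
  set X := (twoCutoffLine (isBlockUnion_fine hR') n a s)⁻¹.mulVec g with hX
  have hmain := (twoCutoff_inv_setDecay hn hR' ha hδ0 hδ1 hsmall hs0 hs1 S T hT ρ₀ hρ₀ g hg).2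
  have hdot : f ⬝ᵥ X = ∑ i ∈ S, f i * X i := by
    unfold dotProduct
    rw [← Finset.sum_subset (Finset.subset_univ S)]
    intro i _ hi
    rw [hf i hi, zero_mul]
  have hCS : (∑ i ∈ S, f i * X i) ^ 2 ≤ (∑ i ∈ S, f i ^ 2) * (∑ i ∈ S, X i ^ 2) :=
    Finset.sum_mul_sq_le_sq_mul_sq S f X
  have hfS : ∑ i ∈ S, f i ^ 2 ≤ ∑ i, f i ^ 2 :=
    Finset.sum_le_sum_of_subset_of_nonneg (Finset.subset_univ S) fun i _ _ => sq_nonneg _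
  have hf0 : 0 ≤ ∑ i, f i ^ 2 := Finset.sum_nonneg fun i _ => sq_nonneg _
  have hXS : 0 ≤ ∑ i ∈ S, X i ^ 2 := Finset.sum_nonneg fun i _ => sq_nonneg _
  rw [hdot]
  calc (∑ i ∈ S, f i * X i) ^ 2 ≤ (∑ i ∈ S, f i ^ 2) * (∑ i ∈ S, X i ^ 2) := hCS
    _ ≤ (∑ i, f i ^ 2) * ((2 / (min 2 a / (L : ℝ) ^ (d + 1))) ^ 2 * Real.exp (-(2 * (δ * ρ₀))) * ∑ x, g x ^ 2) :=
        mul_le_mul hfS hmain hXS hf0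
    _ = (2 / (min 2 a / (L : ℝ) ^ (d + 1))) ^ 2 * Real.exp (-(2 * (δ * ρ₀))) * (∑ x, f x ^ 2) * (∑ x, g x ^ 2) := by
        ring

end TwoCutoff

/-! ### §3 B4's regions: the two fine regions over a finite set of unit labels -/

section Region

open Literature.MathematicalPhysics.QuantumFieldTheory.Balaban1983to89.B4Prop31Zero (image_blk_fineDom finePt_mem_fineDom)

variable {n L : ℕ}

/-- **run B's fine region over the unit labels `Ω`** — `fineDom L (fineDom n Ω)` (the `η_B = 1∕(nL)`-sites over run A's
`η_A`-sites over `Ω`) — is a union of `nL`-blocks (each `nL`-block over `y ∈ Ω` is present in full). [folklore] -/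
theorem isBlockUnion_fineDom_fineDom (hn : 1 ≤ n) (hL : 1 ≤ L) (Ω : Finset (Fin (d + 1) → ℤ)) :
    IsBlockUnion (n * L) (fineDom L (fineDom n Ω)) := by
  intro x hx z hz
  rw [mem_fineDom hL, mem_fineDom hn, blk_blk] at hx ⊢
  rw [Nat.mul_comm] at hz
  rw [hz]
  exact hx

/-- run A's sites over `Ω` are the `L`-block labels of run B's: `(fineDom L (fineDom n Ω)).image (blk L) = fineDom n Ω`.
[folklore] -/
theorem image_blk_fineDom_fineDom (hL : 1 ≤ L) (Ω : Finset (Fin (d + 1) → ℤ)) :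
    (fineDom L (fineDom n Ω)).image (blk L) = fineDom n Ω :=
  image_blk_fineDom hL _

end Region

end Summit.QuantumFields.BalabanUV.T4Continuum.NE7K1LinSchurLineU1Set
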